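import Literature.MathematicalPhysics.QuantumFieldTheory.Balaban1983to89.B9Eq315QkLocalLetter
import Literature.MathematicalPhysics.QuantumFieldTheory.Balaban1983to89.B9Eq315QAdjointFarField
import Literature.MathematicalPhysics.QuantumFieldTheory.Balaban1983to89.B9Eq315QTowerRegularityDisplay
import Literature.MathematicalPhysics.QuantumFieldTheory.Balaban1983to89.B7Prop4GeneralInduction
import Literature.MathematicalPhysics.QuantumFieldTheory.Balaban1983to89.B9Eq347LocalFromBlockDecay
import Literature.MathematicalPhysics.QuantumFieldTheory.Balaban1983to89.Beta.RemainderHasMajGreenPrime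

/-!
# T. Bałaban, *Propagators for lattice gauge theories in a background field*, Commun. Math. Phys. **99** (1985) 389–434
# [Balaban1985BackgroundPropagators] (3.15)–(3.16) p. 393, (3.49) p. 399, (3.35) p. 396 with [Balaban1985Averaging] p. 24, (126)–(127) pp. 36–37, Prop. 2
# (52)–(54) p. 26 and [Balaban1985Variational] (129) p. 297, (190) p. 308: **THE TOWER AVERAGING `Q_k(U)` AS THE `hQ`-SHAPED FINITE-RANGE `B11SectG.HasMaj`
# OF ROW (D4) BETWEEN THE SUP SIZES OF (190) — HEIGHT-FREE (summable regularity regime; on print's class the regime is READ OFF the plaquette window)**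

CITATION HEADER (lean-in-tree rule 2026-08-18).  Sources: [Balaban1985BackgroundPropagators] (B9; held `paper:balaban1985-cmp99-background-propagators`,
journal page = PDF page + 388): (3.15)–(3.16) p. 393 *«Q_k(U) = Q(Ū^{k−1})…Q(U)»* (the composite vector averaging), (3.42) p. 397 (the block shape of the
letters), (3.49) p. 399 (unit blocks), (3.35)–(3.37) p. 396 (small-field class); [Balaban1985Averaging] (B7; `paper:balaban1985-cmp98-averaging`): p. 24
*«this definition is local … depends only on the bond variables … b ⊂ B^k(c₋) ∪ B^k(c₊)»* (RANGE ONE BLOCK), (126)–(127) pp. 36–37 (the sup bound of `Q(U)`),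
Prop. 2 (52)–(54) p. 26 (the level backgrounds stay in the class; geometric plaquette profile); [Balaban1985Variational] (B11): (129) p. 297 (`H₀ = GQ*(QGQ*)⁻¹`:
where `Q` and `Q*` enter NODE D's derivative (182)), (190) p. 308; [Balaban1984PropagatorsII] (B6) (2.51)–(2.52) p. 232, (2.46) p. 231, Lemma 2.1 (2.61) p. 234.
Loci as printed in the headers of the tree files consumed (`B9Eq315QkLocalLetter`, `B9Eq315QAdjointFarField`, `B9Eq315QTowerRegularityDisplay`) and as read by
gens 100–109 of this lineage (memo `FLAT-LETTERS-LOCATED.md`); [B9] pp. 420–422 ((3.126), (3.129) *«H₁B = G₁Q*(QG₁Q*)⁻¹B»*) re-read this generation in the held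
text layer.

WHY THIS FILE (audit cell `pub-balaban`, BINDER row (D4), OWNER lineage `b2b-balaban-beta-an4`, gen 110; plan «Y4b», journal [AN4-G110-INTENT-2]).
The END of NODE D at the origin in a background, `Beta.RemainderOriginTwoLetters.ineq190_origin_of_two_letters` (V79), takes — besides the two analytic
letters `hG0` (bond Green's function) and `hInv₀` (`(QG₀Q*)⁻¹`; on NE9's tower a tree theorem by name after «Y4a» `Beta.RemainderHasMajQG1QInvTowerClosed`) —
the STRUCTURAL letters of the averaging `Q` and of its adjoint `Q*`: `hQ : HasMaj bN bQ Q K_Q` with `K_Q ≥ 0` of FINITE RANGE (`K_Q(a,b) ≠ 0 → dist(a,b) ≤ r_Q`)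
and bounded row sums (`hKQ`, `hQloc`, `hQrow`), and the like for `Q*`.  On the NE9 cell's TOWER (`B9Eq326OperatorTower.QkW`: the fine bonds of `T_{L^{n+1}m}`
with weight `c₀` → the coarse bonds of `T_m` with weight `c₁`, typed with a per-level regularity display `α_j ≤ 1∕64`, `hU1`, `hreg`) every ingredient of `hQ` is
IN THE TREE: the pointwise letter `B9Eq315QkLocalLetter.local_QkW` (ne9-leaf-03; value `M_φ′M_φ·Π_{j<n+1}(1 + 50(d+1)α_j)`), the far-field vanishing
`B9Eq315QAdjointFarField.block_QkW_eq_zero_of_far` (ne9-leaf-01, text t4-ne9-idea-1; `1 < d_∞(u,v) ⟹ r_u ∘ Q_{n+1}(U) ∘ P_v = 0`), the level product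
`B9Eq315QAdjointBlockDecay.prod_level_le_exp` (ne9-leaf-03; `Π ≤ e^{50(d+1)A}` when `Σ_{j<n+1} α_j ≤ A`), and the geometric regularity profile on print's class
`B9Eq315QTowerRegularityDisplay.exists_reg_profile_of_pdev` (ne9-leaf-02; `α_j ≤ 32(d+1)(d+4)α₀·(L^{−2})^j` from the plaquette window (52)).  THIS FILE
assembles them in the (D4) socket's currency:
* §1 **`hasMaj_supSize_of_local₂`** ([folklore]) — the TWO-CARRIER form of `Beta.RemainderHasMajGreenPrime.hasMaj_supSize_of_local` (a local letter
  `(X → E) → (X′ → E′)` is a block majorant between the sup sizes `B11SupSize190.supSize` on the two point sets), needed for every map between the fine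
  and the coarse lattice (`Q`, `Q*`, `H₀`);
* §2 **`hasMaj_QkW_tower_sup`** — in a summable regime `Σ_{j<n+1} α_j ≤ A`: `HasMaj S^{fine}_m S^{coarse}_m ((e′ ∘ Q_{n+1}(U) ∘ e⁻¹)↾ℝ) K_Q`,
  `K_Q(y,v) = M·𝟙[d_∞(y,v) ≤ 1]`, `M = M_φ′M_φ·e^{50(d+1)A}` — ONE constant for every height `n`, every period `m`, every torus geometry;
* §4 **`exists_hasMaj_QkW_tower_of_pdev`** — ON PRINT's CLASS the regime is DERIVED: for `U` with values in an averaging-closed subgroup ([B7] Prop. 2's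
  class) and `pdev(U) < α₀·(L^{n+1})^{−2}` (`0 < α₀`, `C₀α₀ ≤ 1∕3`, `4α₀ ≤ c₂′`, `2 ≤ L`) there is ONE display `α` (with its `hα1`, `hreg`) such that §2 holds
  for `Q_{n+1}(U)` typed with it, with `M = M_φ′M_φ·e^{50(d+1)·64(d+1)(d+4)α₀}` — a function of `(d, α₀, M_φ, M_φ′)` ALONE;
* §5 **`hasMaj_supSize_id`** ([folklore]) — the identity is majorized by `𝟙[y = v]` (V79's `hJ` when the B-data are the coarse Q-images, `J = 1`), with
  `kernelId_nonneg` ∕ `kernelId_loc` (`r_J = 0`) ∕ `kernelId_colSum` (`ν_J = 1`);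
* §3 the kernel facts V79 consumes: **`kernelQ_nonneg`**, **`kernelQ_loc`** (`K_Q(y,v) ≠ 0 ⟹ dist(y,v) ≤ d` in the geometry `toB6 (torusGeom m …)`, whose
  distance is `d₁ ≤ d·d_∞`: `r_Q = d`), **`kernelQ_rowSum`** ∕ **`kernelQ_colSum`** (`≤ M·e·K_d(1)` by `B4Sect5Torus.torusSum_le`: `ν_Q = ν_s = M·e·K_d(1)`).
AFTER «Y4a» AND THIS FILE the letters of V79 on NE9's tower that are NOT tree theorems by name are (besides `hJ`, which §5 serves when `J = 1`): `hG0` (the height-free sup row of the bond Green's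
function `G₁,k` — [5] Thm 3.3 (3.42) first entry; NE9 plan v11: decayed tower local part + storey J at the tower + the letter algebra; OPEN, owned in the
NE9 cell) and `hQs` (the pointwise letter of the ADJOINT `Q_{n+1}(U)†` coarse → fine: its `L²` block letter `B9Eq315QAdjointBlockDecay.norm_block_adjoint_QkW_le_
heightFree` carries `√(d·c₁∕c₀)` and read pointwise costs the height; a height-free POINTWISE letter of `Q†` — the adjoint of a transported block-and-line
average with respect to the two weighted pairings is a weighted, transported block extension — is elementary but NOT typed in the tree: recorded as the next
structural brick), plus the structural `hJ`, `hD2`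
((3.137), `B9Eq3134MatrixConcrete`) and the numerics; NODE O (the identification of Bałaban's step-`k` objects with these operators; the multi-level `{Ω_j}`
case) FROZEN (0).

HONEST SCOPE.  [folklore] composition BY NAME + counting; NO estimate of [5] ∕ [4] ∕ [15] is proved here; the constants are the cell's crude ones
(`50(d+1)`, `32(d+1)(d+4)`, the factor `2` of the geometric sum), not print's `O(1)`; the regularity display `(α, hα1, hU1, hreg)` is the one the tower
operator is TYPED with (§2 displayed; §4 produced from (52) — the VALUE of `Q_{n+1}(U)` should not depend on the display — cf. the one-step congruence
`B9Eq315QTowerLipschitz.QtorusLin_apply_eq_of_eq` —, but the statement is about the operator typed with the produced display); `hU1` (unit-ball level bond variables) stays displayed in §4 (on the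
unitary class it is `Beta.RemainderHasMajGreenPrimeTowerDecayCoshPlaquette.levels_unitary_of_plaq` ∘ `unitaryUnits_le_U1`, not repeated).  NE9's tower =
[15]'s case `Ω_k = T_η`.  Row (D4) class UNCHANGED (instance 0∕1; critical-path width 0 = NODE O; D4 DISCHARGE NO DATE); NOT B12 Thm 2, NOT BetaPertH, NOT
continuum, NOT Clay.  HONEST DEPENDENCY (cell line): continuum YM on T⁴ ⇐ BetaPertH ∧ nine spine estimates (0/9 proved); BetaPertH ⇐ (D1) ∧ (D4) ∧ CAP+tail;
G-an2-4 gates asym, D1 and NE2/3/4.  NEW file importing `B9Eq315QkLocalLetter`, `B9Eq315QAdjointFarField`, `B9Eq315QTowerRegularityDisplay`,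
`B7Prop4GeneralInduction`, `B9Eq347LocalFromBlockDecay`, `Beta.RemainderHasMajGreenPrime` (all built); nothing modified; 0 `def`; standard axioms; no
`sorry`.  Net new unproved facts: 0.
-/

noncomputable section

open scoped BigOperators InnerProductSpace

namespace Literature.MathematicalPhysics.QuantumFieldTheory.Balaban1983to89.Beta.RemainderHasMajQkTower

open B11SectG B11SupSize190
open B4Sect5Torus (TSite tdist ccoord tdist_nonneg tdist_symm torusSum_le)
open B4Sect5Proof (latticeConst)
open B5TorusCover (UT)
open B9Thm34Ext (toB6)
open B9Thm37GlueTorus (torusGeom tdist1)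
open B9SectCLatticeCarrier (Bond bpos)
open B9Eq311L2Pairing (WL2)
open B9Eq319QprimeTorus (fineP blockCoord)
open B9Eq315QTower (towerP UlevOf)
open B9Eq315QTorus (perCfg cornerSite)
open B9Eq316TowerFlatIsOneStep (siteCast towerP_eq_fineP_pow)
open B7Prop1Explicit (U1 Wcx boxVec)
open B11Eq103H1Complex (BondL2K)
open B9Eq326OperatorTower (QkW)
open B9Eq315QkLocalLetter (local_QkW)
open B9Eq315QAdjointFarField (block_QkW_eq_zero_of_far)
open B9Eq315QAdjointBlockDecay (prod_level_le_exp)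
open B9Eq347LocalFromBlockDecay (block_apply_eq_of_support)
open B9Eq349BlockMultipliers (exists_block_clm_family)
open Beta.RemainderHasMajGreenPrime (hasMaj_supSize_of_local)
open B7Prop2Explicit (pdev AvgClosed C0 c2')
open B9Eq315QTowerRegularityDisplay (exists_reg_profile_of_pdev)
open B7Prop4GeneralInduction (geom_sum_le_two)

/-! ## §1  A local letter between TWO point carriers is a block majorant for the sup sizes of (190) -/

section Local

variable {g : B6.Geometry} {X X' : Type} {E E' : Type} [NormedAddCommGroup E] [Module ℝ E] [NormedAddCommGroup E'] [Module ℝ E']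
  {box : g.Site → Finset X} {blk : X → g.Site} {box' : g.Site → Finset X'} {blk' : X' → g.Site}

/-- **A LOCAL LETTER IS A BLOCK MAJORANT — TWO CARRIERS.**  The two-carrier form of `Beta.RemainderHasMajGreenPrime.hasMaj_supSize_of_local`: for the
sup sizes of (190) on `X → E` (boxes = the fibres of `blk`) and on `X′ → E′` (boxes = the fibres of `blk′`), an `ℝ`-linear `T : (X → E) → (X′ → E′)` and a
kernel `K ≥ 0`: if for every block `v`, every `f` vanishing off the block of `v` with `‖f(x)‖ ≤ F` everywhere and every point `x′`, `‖(Tf)(x′)‖ ≤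
K(blk′ x′, v)·F`, then `HasMaj (supSize g box blk) (supSize g box′ blk′) T K` — *«(size of Tμ near y) ≤ K(y,y′)·(size of μ), μ localised near y′»* for maps
between two lattices (print: the averaging `Q` from the fine bonds to the unit lattice, its adjoint, the minimizer `H₀` from the unit lattice to the fine one).
[cite: Balaban1984PropagatorsII, (2.51)–(2.52) p.232] [cite: Balaban1985Variational, (190) p.308] -/
theorem hasMaj_supSize_of_local₂ (hbox : ∀ y x, x ∈ box y ↔ blk x = y) (hbox' : ∀ y x', x' ∈ box' y ↔ blk' x' = y)
    (T : (X → E) →ₗ[ℝ] (X' → E')) {K : g.Site → g.Site → ℝ} (hK : ∀ y y', 0 ≤ K y y')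
    (hloc : ∀ (v : g.Site) (f : X → E) (F : ℝ), (∀ x, blk x ≠ v → f x = 0) → (∀ x, ‖f x‖ ≤ F) →
      ∀ x', ‖T f x'‖ ≤ K (blk' x') v * F) :
    HasMaj (supSize g box blk) (supSize g box' blk') T K := by
  intro v μ hμ y
  set F : ℝ := (supSize g box blk : BlockNorm g (X → E)).loc v μ with hF
  have hF0 : 0 ≤ F := (supSize g box blk : BlockNorm g (X → E)).loc_nonneg v μ
  have hμv : ∀ x, blk x ≠ v → μ x = 0 := (supSize_isLoc_iff v μ).1 hμ
  have hμF : ∀ x, ‖μ x‖ ≤ F := fun x => by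
    by_cases hx : blk x = v
    · exact norm_apply_le_loc ((hbox v x).2 hx) μ
    · rw [hμv x hx, norm_zero]; exact hF0
  refine loc_le_of_forall (mul_nonneg (hK y v) hF0) fun x' hx' => ?_
  have h := hloc v μ F hμv hμF x'
  rwa [(hbox' y x').1 hx'] at h

end Local

/-! ### Torus bookkeeping (private) -/

section Aux

variable {d : ℕ} {m : Fin d → ℕ}

/-- `ofSite a = y ↔ a = toSite y`. [folklore] -/
private theorem ofSite_eq_iff (a : TSite d m) (y : UT m) : UT.ofSite m a = y ↔ a = UT.toSite m y := by
  constructor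
  · rintro rfl; rfl
  · rintro rfl; rfl

/-- The boxes of the coarse bond-position map are its fibres. [folklore] -/
private theorem mem_boxBond_iff (y : UT m) (c : Bond d m) :
    c ∈ (Finset.univ.filter fun c : Bond d m => bpos c = UT.toSite m y) ↔ UT.ofSite m (bpos c) = y := by
  rw [Finset.mem_filter, ofSite_eq_iff]
  simp

/-- The boxes of the fine-bond big-block map are its fibres. [folklore] -/
private theorem mem_boxFine_iff {L : ℕ} [NeZero L] {n : ℕ} (y : UT m) (b : Bond d (towerP L m (n + 1))) :
    b ∈ (Finset.univ.filter fun b : Bond d (towerP L m (n + 1)) =>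
        blockCoord (L ^ (n + 1)) m (siteCast (towerP_eq_fineP_pow L m (n + 1)) (bpos b)) = UT.toSite m y) ↔
      UT.ofSite m (blockCoord (L ^ (n + 1)) m (siteCast (towerP_eq_fineP_pow L m (n + 1)) (bpos b))) = y := by
  rw [Finset.mem_filter, ofSite_eq_iff]
  simp

variable [∀ i, NeZero (m i)]

/-- `d₁ ≤ d·d_∞` on the torus of blocks. [folklore] -/
private theorem tdist1_le_mul_tdist (y v : UT m) :
    tdist1 m y v ≤ d * tdist m (UT.toSite m y) (UT.toSite m v) := by
  unfold tdist1 tdist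
  have h : ∀ i ∈ (Finset.univ : Finset (Fin d)),
      ((ccoord m (UT.toSite m y) (UT.toSite m v) i : ℕ) : ℝ) ≤
        ((Finset.univ.sup (ccoord m (UT.toSite m y) (UT.toSite m v)) : ℕ) : ℝ) :=
    fun i hi => by exact_mod_cast Finset.le_sup (f := ccoord m (UT.toSite m y) (UT.toSite m v)) hi
  calc ∑ i, ((ccoord m (UT.toSite m y) (UT.toSite m v) i : ℕ) : ℝ)
      ≤ ∑ _i : Fin d, ((Finset.univ.sup (ccoord m (UT.toSite m y) (UT.toSite m v)) : ℕ) : ℝ) :=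
        Finset.sum_le_sum h
    _ = d * ((Finset.univ.sup (ccoord m (UT.toSite m y) (UT.toSite m v)) : ℕ) : ℝ) := by
        rw [Finset.sum_const, Finset.card_univ, Fintype.card_fin, nsmul_eq_mul]

end Aux

/-! ## §2  The tower averaging `Q_k(U)` between the sup sizes: a FINITE-RANGE majorant (range one block), height-free under a summable regularity profile -/

section Tower

variable {d : ℕ} (L : ℕ) [NeZero L] (m : Fin d → ℕ) [∀ i, NeZero (m i)] (n : ℕ)
  {𝔸 : Type*} [NormedRing 𝔸] [NormedAlgebra ℂ 𝔸] [CompleteSpace 𝔸] [NormOneClass 𝔸]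
  {W : Type} [NormedAddCommGroup W] [InnerProductSpace ℂ W] [FiniteDimensional ℂ W] (φ : W ≃ₗ[ℂ] 𝔸) {c₀ c₁ : ℝ} [Fact (0 < c₀)] [Fact (0 < c₁)]
  (U : Bond d (towerP L m (n + 1)) → 𝔸ˣ) (hL : 1 ≤ L) (α : ℕ → ℝ) (hα1 : ∀ j, α j ≤ 1 / 64)
  (hU1 : ∀ (j : ℕ) (x : B7Prop1Explicit.Site d) (κ : Fin d), perCfg (towerP L m (j + 1)) (UlevOf L m (n + 1) U j) x κ ∈ U1 𝔸)
  (hreg : ∀ (j : ℕ) (y : TSite d (towerP L m j)) (κ : Fin d) (r : Fin d → Fin L),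
    ‖((Wcx L (perCfg (towerP L m (j + 1)) (UlevOf L m (n + 1) U j)) (cornerSite L y) κ (boxVec L r) : 𝔸ˣ) : 𝔸) - 1‖ ≤ α j)
  {Mφ Mφ' : ℝ} (hφ : ∀ w, ‖φ w‖ ≤ Mφ * ‖w‖) (hφ' : ∀ X, ‖φ.symm X‖ ≤ Mφ' * ‖X‖) (hMφ : 0 ≤ Mφ) (hMφ' : 0 ≤ Mφ')
  (η₀ L₀ M₀ R : ℝ) (H : Prop)

include hφ hφ' hMφ hMφ' in
/-- **THE TOWER AVERAGING `Q_k(U)` AS A FINITE-RANGE BLOCK MAJORANT BETWEEN THE SUP SIZES OF (190), HEIGHT-FREE.**  For the chain's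
`Q_{n+1}(U) = B9Eq326OperatorTower.QkW` (fine bonds of `T_{L^{n+1}m}`, weight `c₀` → coarse bonds of `T_m`, weight `c₁`; fibre read along `φ`), typed with
the per-level regularity display `α_j ≤ 1∕64` (`hU1`, `hreg`), in a summable regime `Σ_{j<n+1} α_j ≤ A`:
`HasMaj S^{fine}_m S^{coarse}_m ((e′ ∘ Q_{n+1}(U) ∘ e⁻¹)↾ℝ) K_Q`, `K_Q(y,v) = M_φ′M_φ·e^{50(d+1)A}` if `d_∞(y,v) ≤ 1` and `0` otherwise —
the VALUE from ne9-leaf-03's pointwise letter `B9Eq315QkLocalLetter.local_QkW` (at `κ = 0`) with the level product bounded by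
`B9Eq315QAdjointBlockDecay.prod_level_le_exp`, the RANGE from ne9-leaf-01's (text t4-ne9-idea-1) far-field vanishing `B9Eq315QAdjointFarField.block_QkW_eq_zero_of_far`
(`1 < d_∞(u,v) ⟹ r_u ∘ Q_{n+1}(U) ∘ P_v = 0`); ONE constant for every height `n` — the `hQ` binder shape (`K_Q ≥ 0`, finite range, bounded row sums: §3) of
`Beta.RemainderOriginTwoLetters.ineq190_origin_of_two_letters` on NE9's tower.
[cite: Balaban1985BackgroundPropagators, (3.15)–(3.16) p.393, Thm 3.1 (3.42) p.397, (3.49) p.399] [cite: Balaban1985Averaging, p.24, (126)–(127) pp.36–37]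
[cite: Balaban1985Variational, (129) p.297, (190) p.308] [cite: Balaban1984PropagatorsII, (2.51)–(2.52) p.232] -/
theorem hasMaj_QkW_tower_sup (hm : ∀ i, 1 ≤ m i) (hα0 : ∀ j, 0 ≤ α j) {A : ℝ} (hA : ∑ j ∈ Finset.range (n + 1), α j ≤ A) :
    HasMaj
      (supSize (toB6 (torusGeom m η₀ L₀ M₀) R H)
        (fun y => Finset.univ.filter fun b : Bond d (towerP L m (n + 1)) =>
          blockCoord (L ^ (n + 1)) m (siteCast (towerP_eq_fineP_pow L m (n + 1)) (bpos b)) = UT.toSite m y)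
        (fun b => UT.ofSite m (blockCoord (L ^ (n + 1)) m (siteCast (towerP_eq_fineP_pow L m (n + 1)) (bpos b)))) :
          BlockNorm (toB6 (torusGeom m η₀ L₀ M₀) R H) (Bond d (towerP L m (n + 1)) → W))
      (supSize (toB6 (torusGeom m η₀ L₀ M₀) R H)
        (fun y => Finset.univ.filter fun c : Bond d m => bpos c = UT.toSite m y)
        (fun c => UT.ofSite m (bpos c)) : BlockNorm (toB6 (torusGeom m η₀ L₀ M₀) R H) (Bond d m → W))
      (((WL2.linearEquiv ℂ ℂ (fun _ : Bond d m => c₁) : BondL2K ℂ d m c₁ W ≃ₗ[ℂ] (Bond d m → W)).toLinearMap ∘ₗ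
          QkW L m n φ U hL α hα1 hU1 hreg (c₀ := c₀) (c₁ := c₁) ∘ₗ
          (WL2.linearEquiv ℂ ℂ (fun _ : Bond d (towerP L m (n + 1)) => c₀) :
            BondL2K ℂ d (towerP L m (n + 1)) c₀ W ≃ₗ[ℂ] (Bond d (towerP L m (n + 1)) → W)).symm.toLinearMap).restrictScalars ℝ)
      (fun y v => if tdist m (UT.toSite m y) (UT.toSite m v) ≤ 1 then Mφ' * Mφ * Real.exp (50 * (d + 1) * A) else 0) := by
  classical
  have hM : 0 ≤ Mφ' * Mφ * Real.exp (50 * (d + 1) * A) := by positivity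
  refine hasMaj_supSize_of_local₂ (fun y b => mem_boxFine_iff y b) (fun y c => mem_boxBond_iff y c) _
    (fun y v => by split_ifs <;> [exact hM; exact le_rfl]) ?_
  intro v f F hfv hfF c
  -- the carrier element `e⁻¹ f`, whose values are those of `f`
  set f' : BondL2K ℂ d (towerP L m (n + 1)) c₀ W :=
    (WL2.linearEquiv ℂ ℂ (fun _ : Bond d (towerP L m (n + 1)) => c₀) :
      BondL2K ℂ d (towerP L m (n + 1)) c₀ W ≃ₗ[ℂ] (Bond d (towerP L m (n + 1)) → W)).symm f with hf'
  have hfv' : ∀ b, blockCoord (L ^ (n + 1)) m (siteCast (towerP_eq_fineP_pow L m (n + 1)) (bpos b)) ≠ UT.toSite m v →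
      WL2.equiv ℂ (fun _ : Bond d (towerP L m (n + 1)) => c₀) W f' b = 0 := by
    intro b hb
    have hne : UT.ofSite m (blockCoord (L ^ (n + 1)) m (siteCast (towerP_eq_fineP_pow L m (n + 1)) (bpos b))) ≠ v :=
      fun h => hb ((ofSite_eq_iff _ _).1 h)
    exact hfv b hne
  have hfF' : ∀ b, ‖WL2.equiv ℂ (fun _ : Bond d (towerP L m (n + 1)) => c₀) W f' b‖ ≤ F := fun b => hfF b
  have hF0 : 0 ≤ F := (norm_nonneg _).trans (hfF (fun _ => 0, c.2))
  -- the value of `(Q_{n+1}(U) f)(c)` is that of the conjugated map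
  have hval : (((WL2.linearEquiv ℂ ℂ (fun _ : Bond d m => c₁) : BondL2K ℂ d m c₁ W ≃ₗ[ℂ] (Bond d m → W)).toLinearMap ∘ₗ
          QkW L m n φ U hL α hα1 hU1 hreg (c₀ := c₀) (c₁ := c₁) ∘ₗ
          (WL2.linearEquiv ℂ ℂ (fun _ : Bond d (towerP L m (n + 1)) => c₀) :
            BondL2K ℂ d (towerP L m (n + 1)) c₀ W ≃ₗ[ℂ] (Bond d (towerP L m (n + 1)) → W)).symm.toLinearMap).restrictScalars ℝ) f c =
        WL2.equiv ℂ (fun _ : Bond d m => c₁) W (QkW L m n φ U hL α hα1 hU1 hreg (c₀ := c₀) (c₁ := c₁) f') c := rfl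
  rw [hval]
  by_cases hc : tdist m (bpos c) (UT.toSite m v) ≤ 1
  · -- near field: the pointwise letter at `κ = 0`, the level product bounded height-free
    rw [UT.toSite_ofSite, if_pos hc]
    have h := local_QkW L m n φ U hL α hα1 hU1 hreg hφ hφ' hMφ hMφ' (c₀ := c₀) (c₁ := c₁) hm le_rfl (UT.toSite m v) f' F hfv' hfF' c
    rw [Real.exp_zero, zero_mul, neg_zero, Real.exp_zero, mul_one, mul_one] at h
    have hP := prod_level_le_exp (d := d) n α hα0 hA
    have hprod : 0 ≤ ∏ j ∈ Finset.range (n + 1), (1 + 50 * (d + 1) * α j) :=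
      Finset.prod_nonneg fun j _ => by nlinarith [hα0 j]
    calc _ ≤ Mφ' * Mφ * (∏ j ∈ Finset.range (n + 1), (1 + 50 * (d + 1) * α j)) * F := h
      _ ≤ Mφ' * Mφ * Real.exp (50 * (d + 1) * A) * F := by
          have := mul_le_mul_of_nonneg_left hP (mul_nonneg hMφ' hMφ)
          exact mul_le_mul_of_nonneg_right this hF0
  · -- far field: `r_u ∘ Q ∘ P_v = 0` at `u = c₋`
    rw [UT.toSite_ofSite, if_neg hc, zero_mul]
    have huv : 1 < tdist m (bpos c) (UT.toSite m v) := not_le.mp hc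
    obtain ⟨PB, hPB⟩ := exists_block_clm_family (𝕜 := ℂ) (w := fun _ : Bond d (towerP L m (n + 1)) => c₀) (V := W)
      (fun b : Bond d (towerP L m (n + 1)) => blockCoord (L ^ (n + 1)) m (siteCast (towerP_eq_fineP_pow L m (n + 1)) (bpos b)))
    obtain ⟨rF, hrF⟩ := exists_block_clm_family (𝕜 := ℂ) (w := fun _ : Bond d m => c₁) (V := W) (fun c : Bond d m => bpos c)
    have hzero := block_QkW_eq_zero_of_far L m n φ U hL α hα1 hU1 hreg hφ hφ' hMφ hMφ' (c₀ := c₀) (c₁ := c₁) hPB hrF hm hα0 huv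
    have hfix : PB (UT.toSite m v) f' = f' := block_apply_eq_of_support hPB (UT.toSite m v) f' hfv'
    have hpt : WL2.equiv ℂ (fun _ : Bond d m => c₁) W (QkW L m n φ U hL α hα1 hU1 hreg (c₀ := c₀) (c₁ := c₁) f') c =
        WL2.equiv ℂ (fun _ : Bond d m => c₁) W
          ((rF (bpos c) ∘L LinearMap.toContinuousLinearMap (QkW L m n φ U hL α hα1 hU1 hreg (c₀ := c₀) (c₁ := c₁)) ∘L
            PB (UT.toSite m v)) f') c := by
      rw [ContinuousLinearMap.comp_apply, ContinuousLinearMap.comp_apply, hfix, hrF, if_pos rfl]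
      rfl
    rw [hpt, hzero]
    simp

end Tower


/-! ## §4  Print's class: the regularity display READ OFF the plaquette window (52), the summable regime DERIVED — `∃ α` with ONE constant `M(d, α₀)` -/

section Plaquette

variable {d : ℕ} (L : ℕ) [NeZero L] (m : Fin d → ℕ) [∀ i, NeZero (m i)] (n : ℕ)
  {𝔸 : Type*} [NormedRing 𝔸] [NormedAlgebra ℂ 𝔸] [CompleteSpace 𝔸] [NormOneClass 𝔸]
  {W : Type} [NormedAddCommGroup W] [InnerProductSpace ℂ W] [FiniteDimensional ℂ W] (φ : W ≃ₗ[ℂ] 𝔸) {c₀ c₁ : ℝ} [Fact (0 < c₀)] [Fact (0 < c₁)]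
  (U : Bond d (towerP L m (n + 1)) → 𝔸ˣ) (hL : 1 ≤ L) (hL2 : 2 ≤ L)
  (hU1 : ∀ (j : ℕ) (x : B7Prop1Explicit.Site d) (κ : Fin d), perCfg (towerP L m (j + 1)) (UlevOf L m (n + 1) U j) x κ ∈ U1 𝔸)
  {G : Subgroup 𝔸ˣ} (hG : AvgClosed d L G) (hU : ∀ (x : B7Prop1Explicit.Site d) (κ : Fin d), perCfg (towerP L m (n + 1)) U x κ ∈ G)
  {α₀ : ℝ} (hα : 0 < α₀) (hα3 : C0 d * α₀ ≤ 1 / 3) (hα4 : 4 * α₀ ≤ c2' d L)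
  (h52 : pdev (perCfg (towerP L m (n + 1)) U) < α₀ * (((L : ℝ) ^ (n + 1))⁻¹) ^ 2)
  {Mφ Mφ' : ℝ} (hφ : ∀ w, ‖φ w‖ ≤ Mφ * ‖w‖) (hφ' : ∀ X, ‖φ.symm X‖ ≤ Mφ' * ‖X‖) (hMφ : 0 ≤ Mφ) (hMφ' : 0 ≤ Mφ')

include hL2 hG hU hα hα3 hα4 h52 hφ hφ' hMφ hMφ' in
/-- **ON PRINT's CLASS THE SUMMABLE REGIME IS DERIVED**: for a background `U` of the height-`(n+1)` tower with values in an averaging-closed subgroup `G`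
([B7] Prop. 2's class: e.g. the unitaries) and plaquette deviation `pdev(U) < α₀·(L^{n+1})^{−2}` (print's (52) ∕ (3.35) on the finest lattice, `0 < α₀`,
`C₀α₀ ≤ 1∕3`, `4α₀ ≤ c₂′`), ne9-leaf-02's `B9Eq315QTowerRegularityDisplay.exists_reg_profile_of_pdev` supplies ONE regularity display `α` (`0 ≤ α ≤ 1∕64`,
`hreg` at every depth) with the GEOMETRIC profile `α_j ≤ 32(d+1)(d+4)α₀·(L^{−2})^j` on the levels `j < n+1`; hence `Σ_{j<n+1} α_j ≤ 64(d+1)(d+4)α₀`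
(`B7Prop4GeneralInduction.geom_sum_le_two`) and §2 gives, for the tower averaging TYPED WITH THAT DISPLAY,
`HasMaj S^{fine}_m S^{coarse}_m ((e′ ∘ Q_{n+1}(U) ∘ e⁻¹)↾ℝ) K_Q` with `K_Q = M·𝟙[d_∞ ≤ 1]`, `M = M_φ′M_φ·e^{50(d+1)·64(d+1)(d+4)α₀}` — a function of
`(d, α₀, M_φ, M_φ′)` ALONE, for every height, period and geometry.  (The VALUE of `Q_{n+1}(U)` should not depend on the display it is typed with — cf. the
one-step congruence `B9Eq315QTowerLipschitz.QtorusLin_apply_eq_of_eq`; a consumer holding another display transports along such congruences.)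
[cite: Balaban1985Averaging, Proposition 2 (52)–(54) p.26, (53) p.26, (126)–(127) pp.36–37, (131) p.38] [cite: Balaban1985BackgroundPropagators, (3.15)–(3.16) p.393, (3.35) p.396, (3.49) p.399]
[cite: Balaban1985Variational, (190) p.308] [cite: Balaban1984PropagatorsII, (2.51)–(2.52) p.232] -/
theorem exists_hasMaj_QkW_tower_of_pdev (hm : ∀ i, 1 ≤ m i) :
    ∃ (α : ℕ → ℝ) (hα1 : ∀ j, α j ≤ 1 / 64)
      (hreg : ∀ (j : ℕ) (y : TSite d (towerP L m j)) (κ : Fin d) (r : Fin d → Fin L),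
        ‖((Wcx L (perCfg (towerP L m (j + 1)) (UlevOf L m (n + 1) U j)) (cornerSite L y) κ (boxVec L r) : 𝔸ˣ) : 𝔸) - 1‖ ≤ α j),
      (∀ j, 0 ≤ α j) ∧ (∀ j < n + 1, α j ≤ 32 * ((d : ℝ) + 1) * ((d : ℝ) + 4) * α₀ * (((L : ℝ) ^ 2)⁻¹) ^ j) ∧
      ∀ (η₀ L₀ M₀ R : ℝ) (H : Prop),
        HasMaj
          (supSize (toB6 (torusGeom m η₀ L₀ M₀) R H)
            (fun y => Finset.univ.filter fun b : Bond d (towerP L m (n + 1)) =>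
              blockCoord (L ^ (n + 1)) m (siteCast (towerP_eq_fineP_pow L m (n + 1)) (bpos b)) = UT.toSite m y)
            (fun b => UT.ofSite m (blockCoord (L ^ (n + 1)) m (siteCast (towerP_eq_fineP_pow L m (n + 1)) (bpos b)))) :
              BlockNorm (toB6 (torusGeom m η₀ L₀ M₀) R H) (Bond d (towerP L m (n + 1)) → W))
          (supSize (toB6 (torusGeom m η₀ L₀ M₀) R H)
            (fun y => Finset.univ.filter fun c : Bond d m => bpos c = UT.toSite m y)
            (fun c => UT.ofSite m (bpos c)) : BlockNorm (toB6 (torusGeom m η₀ L₀ M₀) R H) (Bond d m → W))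
          (((WL2.linearEquiv ℂ ℂ (fun _ : Bond d m => c₁) : BondL2K ℂ d m c₁ W ≃ₗ[ℂ] (Bond d m → W)).toLinearMap ∘ₗ
              QkW L m n φ U hL α hα1 hU1 hreg (c₀ := c₀) (c₁ := c₁) ∘ₗ
              (WL2.linearEquiv ℂ ℂ (fun _ : Bond d (towerP L m (n + 1)) => c₀) :
                BondL2K ℂ d (towerP L m (n + 1)) c₀ W ≃ₗ[ℂ] (Bond d (towerP L m (n + 1)) → W)).symm.toLinearMap).restrictScalars ℝ)
          (fun y v => if tdist m (UT.toSite m y) (UT.toSite m v) ≤ 1 then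
            Mφ' * Mφ * Real.exp (50 * (d + 1) * (64 * ((d : ℝ) + 1) * ((d : ℝ) + 4) * α₀)) else 0) := by
  obtain ⟨α, hα0, hα1, hreg, hprof⟩ := exists_reg_profile_of_pdev L m (n + 1) U hL2 hG hU hα hα3 hα4 h52
  -- the summable regime: a geometric sum with ratio `L⁻² ≤ 1∕4`
  have hL1 : (1 : ℝ) ≤ L := by exact_mod_cast le_trans (by norm_num) hL2
  have hL4 : (4 : ℝ) ≤ (L : ℝ) ^ 2 := by
    have h2 : (2 : ℝ) ≤ L := by exact_mod_cast hL2
    nlinarith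
  have hr0 : (0 : ℝ) ≤ ((L : ℝ) ^ 2)⁻¹ := by positivity
  have hr : ((L : ℝ) ^ 2)⁻¹ ≤ 1 / 2 := by
    rw [inv_le_comm₀ (by positivity) (by norm_num)]
    linarith
  have hA : ∑ j ∈ Finset.range (n + 1), α j ≤ 64 * ((d : ℝ) + 1) * ((d : ℝ) + 4) * α₀ := by
    calc ∑ j ∈ Finset.range (n + 1), α j
        ≤ ∑ j ∈ Finset.range (n + 1), 32 * ((d : ℝ) + 1) * ((d : ℝ) + 4) * α₀ * (((L : ℝ) ^ 2)⁻¹) ^ j :=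
          Finset.sum_le_sum fun j hj => hprof j (Finset.mem_range.mp hj)
      _ = 32 * ((d : ℝ) + 1) * ((d : ℝ) + 4) * α₀ * ∑ j ∈ Finset.range (n + 1), (((L : ℝ) ^ 2)⁻¹) ^ j := by
          rw [Finset.mul_sum]
      _ ≤ 32 * ((d : ℝ) + 1) * ((d : ℝ) + 4) * α₀ * 2 :=
          mul_le_mul_of_nonneg_left (geom_sum_le_two hr0 hr (n + 1)) (by positivity)
      _ = 64 * ((d : ℝ) + 1) * ((d : ℝ) + 4) * α₀ := by ring
  exact ⟨α, hα1, hreg, hα0, hprof, fun η₀ L₀ M₀ R H =>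
    hasMaj_QkW_tower_sup L m n φ U hL α hα1 hU1 hreg hφ hφ' hMφ hMφ' η₀ L₀ M₀ R H hm hα0 hA⟩

end Plaquette

/-! ## §3  The kernel `K_Q`: non-negative, range one block (`dist ≤ d` in the geometry's `d₁`), row and column sums `≤ M·e·K_d(1)` -/

section Kernel

variable {d : ℕ} (m : Fin d → ℕ)

/-- `K_Q ≥ 0`. [folklore] [cite: Balaban1984PropagatorsII, (2.51)–(2.52) p.232] -/
theorem kernelQ_nonneg {M : ℝ} (hM : 0 ≤ M) (y v : UT m) :
    0 ≤ (if tdist m (UT.toSite m y) (UT.toSite m v) ≤ 1 then M else 0) := by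
  split_ifs <;> [exact hM; exact le_rfl]

/-- **`K_Q` has range one block**: `K_Q(y,v) ≠ 0 ⟹ dist(y,v) ≤ d` in the geometry `toB6 (torusGeom m η₀ L₀ M₀) R H` (whose distance is `d₁ ≤ d·d_∞`) — the
`hQloc`∕`hQsloc` binder of `Beta.RemainderOriginTwoLetters.ineq190_origin_of_two_letters` with `r_Q = d`. [folklore]
[cite: Balaban1985Averaging, p.24] [cite: Balaban1984PropagatorsII, (2.46) p.231] -/
theorem kernelQ_loc [∀ i, NeZero (m i)] (η₀ L₀ M₀ R : ℝ) (H : Prop) {M : ℝ} (y v : UT m)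
    (h : (if tdist m (UT.toSite m y) (UT.toSite m v) ≤ 1 then M else 0) ≠ 0) :
    (toB6 (torusGeom m η₀ L₀ M₀) R H).dist y v ≤ d := by
  by_cases hc : tdist m (UT.toSite m y) (UT.toSite m v) ≤ 1
  · calc (toB6 (torusGeom m η₀ L₀ M₀) R H).dist y v = tdist1 m y v := rfl
      _ ≤ d * tdist m (UT.toSite m y) (UT.toSite m v) := tdist1_le_mul_tdist y v
      _ ≤ d * 1 := mul_le_mul_of_nonneg_left hc (Nat.cast_nonneg d)
      _ = d := mul_one _
  · exact absurd (if_neg hc) h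

/-- **Row sums of `K_Q`**: `Σ_v K_Q(y,v) ≤ M·e·K_d(1)` (`𝟙[t ≤ 1] ≤ e·e^{−t}` and the torus sum `B4Sect5Torus.torusSum_le`) — the `hQrow` binder, `ν_Q = M·e·K_d(1)`.
[folklore] [cite: Balaban1984PropagatorsII, Lemma 2.1 (2.61) p.234] -/
theorem kernelQ_rowSum {M : ℝ} (hM : 0 ≤ M) (hm : ∀ i, 1 ≤ m i) (y : UT m) :
    ∑ v : UT m, (if tdist m (UT.toSite m y) (UT.toSite m v) ≤ 1 then M else 0) ≤ M * Real.exp 1 * latticeConst d 1 := by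
  have hpt : ∀ v : UT m, (if tdist m (UT.toSite m y) (UT.toSite m v) ≤ 1 then M else 0) ≤
      M * Real.exp 1 * Real.exp (-(1 * tdist m (UT.toSite m y) (UT.toSite m v))) := by
    intro v
    split_ifs with hc
    · have h1 : (1 : ℝ) ≤ Real.exp 1 * Real.exp (-(1 * tdist m (UT.toSite m y) (UT.toSite m v))) := by
        rw [← Real.exp_add]
        exact Real.one_le_exp (by linarith)
      calc M = M * 1 := (mul_one M).symm
        _ ≤ M * (Real.exp 1 * Real.exp (-(1 * tdist m (UT.toSite m y) (UT.toSite m v)))) := mul_le_mul_of_nonneg_left h1 hM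
        _ = _ := by ring
    · positivity
  calc ∑ v : UT m, (if tdist m (UT.toSite m y) (UT.toSite m v) ≤ 1 then M else 0)
      ≤ ∑ v : UT m, M * Real.exp 1 * Real.exp (-(1 * tdist m (UT.toSite m y) (UT.toSite m v))) := Finset.sum_le_sum fun v _ => hpt v
    _ = M * Real.exp 1 * ∑ v : TSite d m, Real.exp (-(1 * tdist m (UT.toSite m y) v)) := by rw [← Finset.mul_sum]; rfl
    _ ≤ M * Real.exp 1 * latticeConst d 1 :=
        mul_le_mul_of_nonneg_left (torusSum_le d hm one_pos (UT.toSite m y)) (by positivity)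

/-- **Column sums of `K_Q`**: `Σ_y K_Q(y,v) ≤ M·e·K_d(1)` (symmetry of `d_∞`) — the `hQscol` binder shape. [folklore]
[cite: Balaban1984PropagatorsII, Lemma 2.1 (2.61) p.234] -/
theorem kernelQ_colSum {M : ℝ} (hM : 0 ≤ M) (hm : ∀ i, 1 ≤ m i) (v : UT m) :
    ∑ y : UT m, (if tdist m (UT.toSite m y) (UT.toSite m v) ≤ 1 then M else 0) ≤ M * Real.exp 1 * latticeConst d 1 := by
  have h := kernelQ_rowSum m hM hm v
  refine le_of_eq_of_le (Finset.sum_congr rfl fun y _ => ?_) h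
  rw [tdist_symm hm]

end Kernel

/-! ## §5  The identity letter `hJ` (V79's source embedding `J = 1` on the coarse bonds): kernel `𝟙[y = v]`, range `0`, column sums `1` -/

section Identity

variable {g : B6.Geometry} [DecidableEq g.Site] {X : Type} {E : Type} [NormedAddCommGroup E] [Module ℝ E]
  {box : g.Site → Finset X} {blk : X → g.Site}

/-- **THE IDENTITY IS MAJORIZED BY THE DIAGONAL KERNEL**: `HasMaj (supSize g box blk) (supSize g box blk) id 𝟙[y = v]` — the `hJ` binder of
`Beta.RemainderOriginTwoLetters.ineq190_origin_of_two_letters` when the B-data ARE the coarse Q-images (`J = 1`, [15] (129): `H₀B = G₀Q*(QG₀Q*)⁻¹B` on the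
unit lattice). [folklore] [cite: Balaban1984PropagatorsII, (2.51)–(2.52) p.232] [cite: Balaban1985Variational, (129) p.297, (190) p.308] -/
theorem hasMaj_supSize_id (hbox : ∀ y x, x ∈ box y ↔ blk x = y) :
    HasMaj (supSize g box blk) (supSize g box blk) (LinearMap.id : (X → E) →ₗ[ℝ] (X → E)) (fun y v => if y = v then 1 else 0) := by
  refine hasMaj_supSize_of_local hbox _ (fun y v => by split_ifs <;> norm_num) ?_
  intro v f F hfv hfF x
  rw [LinearMap.id_apply]
  by_cases hx : blk x = v
  · rw [if_pos hx, one_mul]; exact hfF x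
  · rw [if_neg hx, zero_mul, hfv x hx, norm_zero]

end Identity

section IdentityKernel

variable {d : ℕ} (m : Fin d → ℕ)

/-- `𝟙[y = v] ≥ 0`. [folklore] [cite: Balaban1984PropagatorsII, (2.51)–(2.52) p.232] -/
theorem kernelId_nonneg (y v : UT m) : (0 : ℝ) ≤ (if y = v then 1 else 0) := by
  split_ifs <;> norm_num

/-- **Range `0`**: `𝟙[y = v] ≠ 0 ⟹ dist(y,v) ≤ 0` in the torus geometry (`d₁(y,y) = 0`) — V79's `hJloc` with `r_J = 0`. [folklore]
[cite: Balaban1984PropagatorsII, (2.46) p.231] -/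
theorem kernelId_loc [∀ i, NeZero (m i)] (η₀ L₀ M₀ R : ℝ) (H : Prop) (y v : UT m) (h : (if y = v then (1 : ℝ) else 0) ≠ 0) :
    (toB6 (torusGeom m η₀ L₀ M₀) R H).dist y v ≤ 0 := by
  by_cases hyv : y = v
  · subst hyv
    exact le_of_eq (B9Thm37GlueTorus.tdist1_self y)
  · exact absurd (if_neg hyv) h

/-- **Column sums `1`**: `Σ_y 𝟙[y = v] ≤ 1` — V79's `hJcol` with `ν_J = 1`. [folklore] [cite: Balaban1984PropagatorsII, Lemma 2.1 (2.61) p.234] -/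
theorem kernelId_colSum (v : UT m) : ∑ y : UT m, (if y = v then (1 : ℝ) else 0) ≤ 1 := by
  rw [Finset.sum_ite_eq' Finset.univ v]
  simp

end IdentityKernel

end Literature.MathematicalPhysics.QuantumFieldTheory.Balaban1983to89.Beta.RemainderHasMajQkTower

end
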